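import Literature.NumberTheory.EllipticCurves.IsogenyFromRationalMap
import Literature.NumberTheory.EllipticCurves.ReductionHomomorphismSurjectiveProofs
import Literature.NumberTheory.EllipticCurves.GeomPointReduction
import Literature.NumberTheory.EllipticCurves.FrobeniusTwist
import Literature.RingTheory.Valuation.AlgClosedResidue
import HarnessLib

/-!
# Reduction of an explicit isogeny formula modulo a place; additivity in characteristic `p`

Topic `NumberTheory/EllipticCurves` (trunk T-ELLARITH, notion `cm_endomorphisms_isogeny`).
Sibling file of `Literature.NumberTheory.EllipticCurves.IsogenyFromRationalMap`, whose theorem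
`IsogenyFormula.toIsogeny` — a rational map `(x, y) ↦ (U(x)/h(x)², (S(x) y + T(x))/h(x)³)`
between elliptic curves with `O ↦ O` is a homomorphism (Silverman, *AEC*, Thm. III.4.8) — is
proved there **in characteristic `0` only** (its commutative algebra uses Mathlib's
`Ideal.relNorm_eq_pow_of_isMaximal`, which wants a perfect fraction field). This file transfers
the additivity to **positive characteristic by reduction modulo a place**, for formulae with
coefficients in a valuation ring:

Let `A` be a valuation subring of an algebraically closed field `K` of characteristic `0`
(so `A` is henselian with algebraically closed residue field `k`,
`Literature.RingTheory.Valuation.AlgClosedResidue`), `W₁, W₂` Weierstrass equations over `A`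
with unit discriminants (good reduction) and `φ : IsogenyFormula W₁ W₂` with unit leading
coefficients of `U` and `h`. Then the reduced formula `φ̄` over `k`
(`IsogenyFormula.mapOfLeadingCoeff`) satisfies

* `IsogenyFormula.pointFun_add_residue` — `φ̄(P + Q) = φ̄(P) + φ̄(Q)` for all `k`-points
  `P, Q` with `P, Q, P + Q` off the exceptional set `{O} ∪ {h̄(x) = 0}`:

lift `P, Q` to `K`-points (surjectivity of reduction over a henselian ring, the tree's
`exists_reducePoint_eq`, Silverman VII.2.1), apply the characteristic-`0` additivity of the
formula upstairs (`IsogenyFormula.pointFun_add`), and reduce, using that reduction is a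
homomorphism (`reducePoint_add`, *AEC* VII.2.1) and commutes with the formula at points where
`h` is a unit (`reducePoint_pointFun`). Also recorded: the base change of a formula along a ring
map under which the leading coefficients of `U, h` survive (`mapOfLeadingCoeff`), the
compatibility of the point map with homomorphisms of fields (`mapPoint_pointFun`,
`mapPoint_mem_bad_iff`); good reduction of all points for a unit discriminant is the tree's
`Literature.NumberTheory.EllipticCurves.hasNonsingularReduction_of_isUnit_Δ` (`GeomPointReduction`).

Consumer: `IsogenyFormulaOfPlace` (the isogeny over `𝔽_p` attached to such a formula, used for
the reduction of complex multiplications in `ComplexMultiplicationDeuringReductionProofs`).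

## References

* [SilvermanAEC2009] J. H. Silverman, *The Arithmetic of Elliptic Curves*, 2nd ed., GTM 106
  (2009): Thm. III.4.8, Prop. VII.2.1; [SilvermanAdvancedTopics1994] J. H. Silverman, *Advanced
  Topics*, Prop. II.4.4 (reduction of isogenies preserves the group structure).

## Design

`noncomputable section`, `open scoped Classical`; deliberate dot-notation extensions in
`namespace WeierstrassCurve.IsogenyFormula` (the structure of `IsogenyFromRationalMap`) and
`WeierstrassCurve`. Theorems and definitions-with-body (`mapOfLeadingCoeff`, `gen`, `red`, all
`IsogenyFormula`s; no new `Prop` facts). Polynomial evaluation along ring maps is Mathlib's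
`Polynomial.eval_map_apply`; residues of units, `IsLocalRing.residue_ne_zero_iff_isUnit`.
-/

noncomputable section

open scoped Classical

open Polynomial IsLocalRing

universe u v

namespace WeierstrassCurve

namespace IsogenyFormula

/-! ## Base change along a general ring map -/

section MapOfLeadingCoeff

variable {R : Type u} {S : Type v} [CommRing R] [CommRing S] {W₁ W₂ : WeierstrassCurve R}

/-- **Base change of an isogeny formula along a ring map `f : R → S` under which the leading
coefficients of `U` and `h` do not vanish** (e.g. reduction modulo a prime of a formula with monic
`U, h`): the two identities are transported by `Polynomial.map`, `h̄ ≠ 0`, and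
`deg h̄² ≤ deg h² < deg U = deg Ū`. Compare `IsogenyFormula.map` (injective `f`). [folklore] -/
def mapOfLeadingCoeff (φ : IsogenyFormula W₁ W₂) (f : R →+* S) (hU : f φ.U.leadingCoeff ≠ 0)
    (hh : f φ.h.leadingCoeff ≠ 0) : IsogenyFormula (W₁.map f) (W₂.map f) where
  U := φ.U.map f
  h := φ.h.map f
  S := φ.S.map f
  T := φ.T.map f
  identity₁ := by
    simpa only [Polynomial.map_add, Polynomial.map_mul, Polynomial.map_pow, Polynomial.map_sub,
      Polynomial.map_neg, Polynomial.map_ofNat, map_C, map_X, map_a₁, map_a₃] using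
      congrArg (Polynomial.map f) φ.identity₁
  identity₀ := by
    simpa only [Polynomial.map_add, Polynomial.map_mul, Polynomial.map_pow, Polynomial.map_sub,
      Polynomial.map_neg, Polynomial.map_ofNat, map_C, map_X, map_a₁, map_a₂, map_a₃, map_a₄,
      map_a₆] using congrArg (Polynomial.map f) φ.identity₀
  h_ne_zero := fun h0 ↦ hh (by
    have := congrArg Polynomial.leadingCoeff h0
    rwa [leadingCoeff_map_of_leadingCoeff_ne_zero f hh, leadingCoeff_zero] at this)
  natDegree_lt := by
    calc ((φ.h.map f) ^ 2).natDegree = ((φ.h ^ 2).map f).natDegree := by rw [Polynomial.map_pow]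
      _ ≤ (φ.h ^ 2).natDegree := natDegree_map_le
      _ < φ.U.natDegree := φ.natDegree_lt
      _ = (φ.U.map f).natDegree := (natDegree_map_of_leadingCoeff_ne_zero f hU).symm

variable (φ : IsogenyFormula W₁ W₂) (f : R →+* S) (hU : f φ.U.leadingCoeff ≠ 0)
  (hh : f φ.h.leadingCoeff ≠ 0)

/-- The data of the base-changed formula. [folklore] -/
@[simp] theorem mapOfLeadingCoeff_U : (φ.mapOfLeadingCoeff f hU hh).U = φ.U.map f := rfl
/-- The data of the base-changed formula. [folklore] -/
@[simp] theorem mapOfLeadingCoeff_h : (φ.mapOfLeadingCoeff f hU hh).h = φ.h.map f := rfl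
/-- The data of the base-changed formula. [folklore] -/
@[simp] theorem mapOfLeadingCoeff_S : (φ.mapOfLeadingCoeff f hU hh).S = φ.S.map f := rfl
/-- The data of the base-changed formula. [folklore] -/
@[simp] theorem mapOfLeadingCoeff_T : (φ.mapOfLeadingCoeff f hU hh).T = φ.T.map f := rfl

end MapOfLeadingCoeff

/-! ## The point map along a homomorphism of fields -/

section MapPoint

variable {F : Type u} {L : Type v} [Field F] [Field L] (g : F →+* L)
  {W₁ W₂ : WeierstrassCurve F} {V₁ V₂ : WeierstrassCurve L} (h₁ : W₁.map g = V₁)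
  (h₂ : W₂.map g = V₂) (φ : IsogenyFormula W₁ W₂) (φ' : IsogenyFormula V₁ V₂)
  (hh : φ'.h = φ.h.map g)

include hh in
/-- The exceptional sets of a formula and of its image along a field homomorphism correspond.
[folklore] -/
theorem mapPoint_mem_bad_iff (P : W₁.toAffine.Point) :
    mapPoint g h₁ P ∈ φ'.bad ↔ P ∈ φ.bad := by
  rcases P with _ | ⟨x, y, hxy⟩
  · exact ⟨fun _ ↦ φ.zero_mem_bad, fun _ ↦ φ'.zero_mem_bad⟩
  · rw [mapPoint_some, φ'.some_mem_bad_iff, φ.some_mem_bad_iff, hh, Polynomial.eval_map_apply,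
      map_eq_zero_iff g g.injective]

variable [W₂.IsElliptic] [V₂.IsElliptic] (hU : φ'.U = φ.U.map g) (hS : φ'.S = φ.S.map g)
  (hT : φ'.T = φ.T.map g)

include hU hh hS hT in
/-- **The point map of an isogeny formula commutes with homomorphisms of fields**: if `φ'` is
`φ` read along `g : F → L`, then `g(φ(P)) = φ'(g(P))` for every `F`-point `P` (including the
provisional value `O` on the exceptional set, which corresponds under `g`). [folklore] -/
theorem mapPoint_pointFun (P : W₁.toAffine.Point) :
    mapPoint g h₂ (φ.pointFun P) = φ'.pointFun (mapPoint g h₁ P) := by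
  rcases P with _ | ⟨x, y, hxy⟩
  · rfl
  · have hhx : φ'.h.eval (g x) = g (φ.h.eval x) := by rw [hh, Polynomial.eval_map_apply]
    by_cases hx : φ.h.eval x = 0
    · have hx' : φ'.h.eval (g x) = 0 := by rw [hhx, hx, map_zero]
      rw [φ.pointFun_some_of_eval_eq_zero hxy hx, mapPoint_zero, mapPoint_some,
        φ'.pointFun_some_of_eval_eq_zero _ hx']
    · have hx' : φ'.h.eval (g x) ≠ 0 := by rw [hhx]; exact (map_ne_zero g).mpr hx
      rw [φ.pointFun_some hxy hx, mapPoint_some, mapPoint_some, φ'.pointFun_some _ hx']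
      congr 1
      · simp only [valX, hU, hh, map_div₀, map_pow, Polynomial.eval_map_apply]
      · simp only [valY, hS, hT, hh, map_div₀, map_pow, map_add, map_mul, Polynomial.eval_map_apply]

end MapPoint

end IsogenyFormula

/-! ## Reduction of a formula modulo the maximal ideal of a valuation ring -/

namespace IsogenyFormula

section Residue

open Literature.NumberTheory.EllipticCurves

variable {K : Type u} [Field K] (A : ValuationSubring K) {W₁ W₂ : WeierstrassCurve A}
  (φ : IsogenyFormula W₁ W₂) (hU : IsUnit φ.U.leadingCoeff) (hh : IsUnit φ.h.leadingCoeff)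

/-- The formula read over the fraction field `K`. [folklore] -/
def gen : IsogenyFormula (W₁.baseChange K) (W₂.baseChange K) :=
  φ.map (algebraMap A K) (IsFractionRing.injective A K)

/-- The formula reduced modulo the maximal ideal (leading coefficients of `U`, `h` units).
[folklore] -/
def red : IsogenyFormula (W₁.map (residue A)) (W₂.map (residue A)) :=
  φ.mapOfLeadingCoeff (residue A) ((IsLocalRing.residue_ne_zero_iff_isUnit _).mpr hU)
    ((IsLocalRing.residue_ne_zero_iff_isUnit _).mpr hh)

variable [W₁.IsElliptic] [W₂.IsElliptic]

/-- **Reduction commutes with the formula at points where `h` is a unit.** Let `X` be a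
`K`-point of `W₁` whose reduction `X̃` is an affine point off `h̄ = 0`. Then `X = (a, b)` with
`a, b ∈ A`, `h(a) ∈ A^×`, `X` is off the exceptional set of the formula over `K`, and the
reduction of `φ(X) = (U(a)/h(a)², (S(a)b + T(a))/h(a)³)` (a point with coordinates in `A`) is
`φ̄(X̃)`. Silverman, *Advanced Topics*, II.4.4 (reduction of isogenies), here for explicit
formulae. [folklore] -/
theorem reducePoint_pointFun (X : (W₁.baseChange K).toAffine.Point)
    (hX : W₁.reducePoint X ∉ (φ.red A hU hh).bad) :
    X ∉ (φ.gen A).bad ∧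
      W₂.reducePoint ((φ.gen A).pointFun X) = (φ.red A hU hh).pointFun (W₁.reducePoint X) := by
  set hv := integers_valuationRing_valuation A K with hv_def
  have hinj : Function.Injective (algebraMap A K) := hv.hom_inj
  rcases point_cases hv X with rfl | ⟨x, y, h, rfl, hx⟩ | ⟨a, b, h, rfl⟩
  · exact absurd (φ.red A hU hh).zero_mem_bad (by rwa [reducePoint_zero] at hX)
  · rw [reducePoint_some_of_not_mem h ((not_mem_range_iff hv).mpr hx)] at hX
    exact absurd (φ.red A hU hh).zero_mem_bad hX
  · -- `X = (a, b)` integral; its reduction is `(ā, b̄)`, nonsingular by good reduction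
    have heq : W₁.toAffine.Equation a b := (map_equation_iff hinj).mp h.1
    have hns : (W₁.map (residue A)).toAffine.Nonsingular (residue A a) (residue A b) :=
      Affine.equation_iff_nonsingular.mp (heq.map (residue A))
    rw [reducePoint_some_algebraMap hinj h hns] at hX ⊢
    have hha : (φ.red A hU hh).h.eval (residue A a) ≠ 0 := fun h0 ↦
      hX (((φ.red A hU hh).some_mem_bad_iff hns).mpr h0)
    -- unfolding the reduced and generic data
    have hred_h : (φ.red A hU hh).h.eval (residue A a) = residue A (φ.h.eval a) := by
      change (φ.h.map (residue A)).eval _ = _; rw [Polynomial.eval_map_apply]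
    have hred_U : (φ.red A hU hh).U.eval (residue A a) = residue A (φ.U.eval a) := by
      change (φ.U.map (residue A)).eval _ = _; rw [Polynomial.eval_map_apply]
    have hred_S : (φ.red A hU hh).S.eval (residue A a) = residue A (φ.S.eval a) := by
      change (φ.S.map (residue A)).eval _ = _; rw [Polynomial.eval_map_apply]
    have hred_T : (φ.red A hU hh).T.eval (residue A a) = residue A (φ.T.eval a) := by
      change (φ.T.map (residue A)).eval _ = _; rw [Polynomial.eval_map_apply]
    have hgen_h : (φ.gen A).h.eval (algebraMap A K a) = algebraMap A K (φ.h.eval a) := by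
      change (φ.h.map (algebraMap A K)).eval _ = _; rw [Polynomial.eval_map_apply]
    have hgen_U : (φ.gen A).U.eval (algebraMap A K a) = algebraMap A K (φ.U.eval a) := by
      change (φ.U.map (algebraMap A K)).eval _ = _; rw [Polynomial.eval_map_apply]
    have hgen_S : (φ.gen A).S.eval (algebraMap A K a) = algebraMap A K (φ.S.eval a) := by
      change (φ.S.map (algebraMap A K)).eval _ = _; rw [Polynomial.eval_map_apply]
    have hgen_T : (φ.gen A).T.eval (algebraMap A K a) = algebraMap A K (φ.T.eval a) := by
      change (φ.T.map (algebraMap A K)).eval _ = _; rw [Polynomial.eval_map_apply]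
    -- `h(a)` is a unit of `A`
    have hz : residue A (φ.h.eval a) ≠ 0 := by rwa [hred_h] at hha
    obtain ⟨w, hw⟩ := isUnit_of_residue_ne_zero hz
    have hhaK : (φ.gen A).h.eval (algebraMap A K a) ≠ 0 := by
      rw [hgen_h, ← hw]
      exact (map_ne_zero_iff _ hinj).mpr w.ne_zero
    have hzK : algebraMap A K (φ.h.eval a) ≠ 0 := by rwa [hgen_h] at hhaK
    refine ⟨fun hb ↦ hhaK (((φ.gen A).some_mem_bad_iff h).mp hb), ?_⟩
    -- the value upstairs has coordinates in `A`
    set a' : A := φ.U.eval a * ↑(w⁻¹) ^ 2 with ha'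
    set b' : A := (φ.S.eval a * b + φ.T.eval a) * ↑(w⁻¹) ^ 3 with hb'
    have hwK : algebraMap A K (φ.h.eval a) * algebraMap A K ↑(w⁻¹) = 1 := by
      rw [← map_mul, ← hw, Units.mul_inv, map_one]
    have hvalX : (φ.gen A).valX (algebraMap A K a) = algebraMap A K a' := by
      rw [valX, hgen_U, hgen_h, ha', map_mul, map_pow, div_eq_iff (pow_ne_zero 2 hzK)]
      linear_combination (-(algebraMap A K (φ.U.eval a)) *
        (algebraMap A K (φ.h.eval a) * algebraMap A K ↑(w⁻¹) + 1)) * hwK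
    have hvalY : (φ.gen A).valY (algebraMap A K a) (algebraMap A K b) = algebraMap A K b' := by
      rw [valY, hgen_S, hgen_T, hgen_h, hb', map_mul, map_pow, map_add, map_mul,
        div_eq_iff (pow_ne_zero 3 hzK)]
      linear_combination (-(algebraMap A K (φ.S.eval a) * algebraMap A K b +
        algebraMap A K (φ.T.eval a)) * ((algebraMap A K (φ.h.eval a) * algebraMap A K ↑(w⁻¹)) ^ 2 +
          algebraMap A K (φ.h.eval a) * algebraMap A K ↑(w⁻¹) + 1)) * hwK
    have hns'K : (W₂.baseChange K).toAffine.Nonsingular (algebraMap A K a') (algebraMap A K b') := by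
      rw [← hvalX, ← hvalY]; exact (φ.gen A).nonsingular_val h.1 hhaK
    have hval : (φ.gen A).pointFun (.some _ _ h) = .some (algebraMap A K a') (algebraMap A K b') hns'K := by
      rw [(φ.gen A).pointFun_some h hhaK]
      exact point_some_congr hvalX hvalY
    -- and reduces to the value downstairs
    have hwk : residue A (φ.h.eval a) * residue A ↑(w⁻¹) = 1 := by
      rw [← map_mul, ← hw, Units.mul_inv, map_one]
    have hredX : (φ.red A hU hh).valX (residue A a) = residue A a' := by
      rw [valX, hred_U, hred_h, ha', map_mul, map_pow, div_eq_iff (pow_ne_zero 2 hz)]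
      linear_combination (-(residue A (φ.U.eval a)) *
        (residue A (φ.h.eval a) * residue A ↑(w⁻¹) + 1)) * hwk
    have hredY : (φ.red A hU hh).valY (residue A a) (residue A b) = residue A b' := by
      rw [valY, hred_S, hred_T, hred_h, hb', map_mul, map_pow, map_add, map_mul,
        div_eq_iff (pow_ne_zero 3 hz)]
      linear_combination (-(residue A (φ.S.eval a) * residue A b + residue A (φ.T.eval a)) *
        ((residue A (φ.h.eval a) * residue A ↑(w⁻¹)) ^ 2 +
          residue A (φ.h.eval a) * residue A ↑(w⁻¹) + 1)) * hwk
    have hns' : (W₂.map (residue A)).toAffine.Nonsingular (residue A a') (residue A b') := by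
      rw [← hredX, ← hredY]
      exact (φ.red A hU hh).nonsingular_val hns.1 hha
    rw [hval, reducePoint_some_algebraMap hinj _ hns', (φ.red A hU hh).pointFun_some hns hha]
    exact point_some_congr hredX.symm hredY.symm

variable [IsAlgClosed K] [CharZero K]

/-- **Additivity of a reduced isogeny formula off its exceptional set** (characteristic `p`):
for a valuation subring `A` of an algebraically closed field `K` of characteristic `0`,
Weierstrass equations `W₁, W₂` over `A` with unit discriminants and an isogeny formula `φ` over
`A` whose `U, h` have unit leading coefficients, the reduced formula `φ̄` over the residue field
satisfies `φ̄(P + Q) = φ̄(P) + φ̄(Q)` whenever `P, Q, P + Q` are off `{O} ∪ {h̄ = 0}`. Proof: lift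
`P, Q` to `K`-points (`A` is henselian, `exists_reducePoint_eq`), use the characteristic-`0`
additivity `IsogenyFormula.pointFun_add` upstairs, and reduce (`reducePoint_add`,
`reducePoint_pointFun`). Silverman, *AEC*, Thm. III.4.8 with Prop. VII.2.1; *Advanced Topics*,
Prop. II.4.4. [cite: SilvermanAEC2009, Thm. III.4.8 and Prop. VII.2.1] -/
theorem pointFun_add_residue (P Q : (W₁.map (residue A)).toAffine.Point)
    (hP : P ∉ (φ.red A hU hh).bad) (hQ : Q ∉ (φ.red A hU hh).bad)
    (hPQ : P + Q ∉ (φ.red A hU hh).bad) :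
    (φ.red A hU hh).pointFun (P + Q) = (φ.red A hU hh).pointFun P + (φ.red A hU hh).pointFun Q := by
  haveI := Literature.RingTheory.Valuation.henselianRing_maximalIdeal A
  set hv := integers_valuationRing_valuation A K with hv_def
  have hinj : Function.Injective (algebraMap A K) := hv.hom_inj
  -- lift `P` and `Q`
  obtain ⟨P', -, rfl⟩ := W₁.exists_reducePoint_eq (K := K) hinj P
  obtain ⟨Q', -, rfl⟩ := W₁.exists_reducePoint_eq (K := K) hinj Q
  have hgood : ∀ X : (W₁.baseChange K).toAffine.Point, W₁.HasNonsingularReduction X :=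
    Literature.NumberTheory.EllipticCurves.hasNonsingularReduction_of_isUnit_Δ hv W₁.isUnit_Δ
  have hgood₂ : ∀ Y : (W₂.baseChange K).toAffine.Point, W₂.HasNonsingularReduction Y :=
    Literature.NumberTheory.EllipticCurves.hasNonsingularReduction_of_isUnit_Δ hv W₂.isUnit_Δ
  have hsum : W₁.reducePoint (P' + Q') = W₁.reducePoint P' + W₁.reducePoint Q' :=
    reducePoint_add hv (hgood P') (hgood Q')
  rw [← hsum] at hPQ ⊢
  obtain ⟨hP', eP⟩ := φ.reducePoint_pointFun A hU hh P' hP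
  obtain ⟨hQ', eQ⟩ := φ.reducePoint_pointFun A hU hh Q' hQ
  obtain ⟨hPQ', ePQ⟩ := φ.reducePoint_pointFun A hU hh (P' + Q') hPQ
  rw [← eP, ← eQ, ← ePQ, (φ.gen A).pointFun_add P' Q' hP' hQ' hPQ',
    reducePoint_add hv (hgood₂ _) (hgood₂ _)]

end Residue

end IsogenyFormula

end WeierstrassCurve
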